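import Summits.BirchSwinnertonDyer.BirchSwinnertonDyer.Theorems.ThetaPartnerAtTwoSignedControlAtTwoMuRealShaDualCount
import Summits.BirchSwinnertonDyer.BirchSwinnertonDyer.Theorems.ThetaPartnerAtTwoSignedControlAtTwoMuRealUnramifiedAE
import HarnessLib

/-!
# `poitouTate_sha_tateDual K` BY NAME — for ANY number field — from the two deliverables of the class-formation road:
# Milne I 4.10 (b) for THE invariant maps at every level, and the degree-2 readout `Ш²(K, M) ≅ coker γ¹`

Crux K4 `SignedControlAtTwo` (stmt-BirchSwinnertonDyer-20309; routes `ThetaPartnerAtTwo` / `ResidualThetaTransportAtTwo`), line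
`eulerchar` v12, lead `bsd-wall-tp2-p3` g4 (`--supports stmt-BirchSwinnertonDyer-20309`, helper; CONDITIONAL).  Assembly of
this seat's real-place packet for the registered stub `stub_poitouTateShaRat : poitouTate_sha_tateDual ℚ`
(`…MuRealShaDualAnnihilator`, `…MuRealShaDualCanonical`, `…MuRealShaDualCount`, `…MuRealUnramifiedAE`):

* **`poitouTate_sha_tateDual_of_middleExact_of_readout`** — for ANY number field `K` (real places allowed; `K = ℚ` is K4),
  the named fact `poitouTate_sha_tateDual K` (Milne I Thm. 4.10 (a): `Ш¹(K, M^D)`, `Ш²(K, M)` finite and perfectly paired,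
  for EVERY finite discrete `n`-torsion `M`, every `n ≥ 1`) follows from two displayed hypotheses on THE family
  `LocalInvariants.canonical K n`:  (hE) Milne I 4.10 (b) `Ker γ¹ ⊆ Im β¹` at every level `n` (verbatim the input of
  `PoitouTateReduction.selmerComplement_canonical_of_middleExact_allLevels`; cell bsd-schneider's road (A), doors c5/c6), and
  (hR) for every `(n, M, S₀)` a degree-2 readout `e : Ш²(K, M) → Hom(H¹(K, M^D), ℤ/n)` additive, injective and surjective modulo
  sums of canonical local pairings (archimedean components live) — the dictionary `Ш²(K, M) ≅ H¹(K, M^D)^* / γ¹(P¹(K, M))` of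
  that road (owner: none, INPUTS-LIST-1-v2 §6).  The ramification set `S₀` the clause theorems need is produced inside
  (`exists_finset_place_isUnramifiedAt`), so NO hypothesis beyond (hE), (hR) remains;
* `natCard_shaTwo_le_of_middleExact_of_readout` — the COUNT form K4 actually consumes (`Ш¹(K, M^D)`, `Ш²(K, M)` finite,
  `#Ш² ≤ #Ш¹`) for every finite `n`-torsion `M`, from (hE) and an additive, injective readout only.

HONEST FRAMING. THEOREMS ONLY (no definition, no named fact, no `sorry`); CONDITIONAL on (hE), (hR) — displayed hypotheses of
generic class-field theory, NOT discharged here; closes no item by itself; BSD is not proved by any of this.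
References: [MilneADT2006] I Thm. 4.10 (a)(b) and proof, Thm. 2.13 (a), Ex. 1.6 (c), §4; [Harari2020] Thm. 17.13 (b);
[SerreAbelianLadic1968] Ch. I §2.1.
-/

noncomputable section

open Function NumberField IsDedekindDomain
open scoped NumberField

set_option linter.dupNamespace false
set_option autoImplicit false

namespace Summit.BirchSwinnertonDyer.BirchSwinnertonDyer.Theorems.SignedEC.MuReal

open Literature.NumberTheory.GaloisRepresentations
open Literature.NumberTheory.GaloisRepresentations.DiscreteGaloisModule (mu localTatePairingZMod tateDual
  unramifiedSubgroup sha shaTwo)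
open Literature.NumberTheory.GaloisCohomology

variable {K : Type} [Field K] [NumberField K]

/-- **`poitouTate_sha_tateDual K` from Milne I 4.10 (b) for THE invariant maps (every level) and the degree-2 readout —
ANY number field** (real places allowed).  (hE): at every level `n ≥ 1`, for every finite `n`-torsion `M`, admissible
`S` and family `t ∈ ∏_{v} H¹(K_v, M)` orthogonal to `H¹_S(K, M^D)` under the canonical local pairings, some
`x ∈ H¹_S(K, M)` localises to `t` on `S`.  (hR): for every `n ≥ 1`, finite `n`-torsion `M` and finite `S₀ ∋ ∞` off which
`n` is a unit and `M` unramified, a readout `e : Ш²(K, M) → Hom(H¹(K, M^D), ℤ/n)` which is additive, injective and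
surjective modulo sums `y ↦ ∑_{v ∈ S} inv_v(t_v ∪ y_v)` of canonical local pairings.  CONCLUSION: the named fact
`poitouTate_sha_tateDual K` (Milne I Thm. 4.10 (a), all finite modules).
[cite: MilneADT2006, Ch. I, Thm. 4.10 (a)(b) and proof, Thm. 2.13 (a), Ex. 1.6 (c)] [cite: Harari2020, Thm. 17.13 (b)] -/
theorem poitouTate_sha_tateDual_of_middleExact_of_readout
    (hE : ∀ (n : ℕ) [NeZero n] ⦃M : Type⦄ [AddCommGroup M] [TopologicalSpace M] [DiscreteTopology M] [Finite M]
      (ρ : DiscreteGaloisModule K M), (∀ m : M, n • m = 0) →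
      ∀ S : Finset (Place K), (∀ w : InfinitePlace K, (Sum.inl w : Place K) ∈ S) →
        (∀ v : HeightOneSpectrum (𝓞 K), (Sum.inr v : Place K) ∉ S →
          ((n : ℕ) : 𝓞 K) ∉ v.asIdeal ∧ GaloisRep.IsUnramifiedAt v ρ) →
        ∀ t : Π v : Place K, galoisCohomology (ρ.toLocal v) 1,
          (∀ y : galoisCohomology (ρ.tateDual n) 1,
            (∀ v : HeightOneSpectrum (𝓞 K), (Sum.inr v : Place K) ∉ S →
              galoisCohomology.localization (ρ.tateDual n) (Sum.inr v) 1 y ∈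
                unramifiedSubgroup (GaloisRep.toLocal v (ρ.tateDual n)) 1) →
            ∑ v ∈ S, localTatePairingZMod ρ n v (LocalInvariants.canonical K n v) (t v)
              (galoisCohomology.localization (ρ.tateDual n) v 1 y) = 0) →
          ∃ x : galoisCohomology ρ 1,
            (∀ v : HeightOneSpectrum (𝓞 K), (Sum.inr v : Place K) ∉ S →
              galoisCohomology.localization ρ (Sum.inr v) 1 x ∈
                unramifiedSubgroup (GaloisRep.toLocal v ρ) 1) ∧
            ∀ v ∈ S, galoisCohomology.localization ρ v 1 x = t v)
    (hR : ∀ (n : ℕ) [NeZero n] ⦃M : Type⦄ [AddCommGroup M] [TopologicalSpace M] [DiscreteTopology M] [Finite M]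
      (ρ : DiscreteGaloisModule K M), (∀ m : M, n • m = 0) →
      ∀ S₀ : Finset (Place K), (∀ w : InfinitePlace K, (Sum.inl w : Place K) ∈ S₀) →
        (∀ v : HeightOneSpectrum (𝓞 K), (Sum.inr v : Place K) ∉ S₀ →
          ((n : ℕ) : 𝓞 K) ∉ v.asIdeal ∧ GaloisRep.IsUnramifiedAt v ρ) →
        ∃ e : shaTwo ρ → (galoisCohomology (ρ.tateDual n) 1 →+ ZMod n),
          (∀ c c' : shaTwo ρ, ∃ (S₁ : Finset (Place K)) (t : Π v : Place K, galoisCohomology (ρ.toLocal v) 1),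
            ∀ (y : galoisCohomology (ρ.tateDual n) 1) (S : Finset (Place K)), S₁ ⊆ S →
              (∀ v : HeightOneSpectrum (𝓞 K), (Sum.inr v : Place K) ∉ S →
                galoisCohomology.localization (ρ.tateDual n) (Sum.inr v) 1 y ∈
                  unramifiedSubgroup (GaloisRep.toLocal v (ρ.tateDual n)) 1) →
              (e (c + c') - e c - e c') y =
                ∑ v ∈ S, localTatePairingZMod ρ n v (LocalInvariants.canonical K n v) (t v)
                  (galoisCohomology.localization (ρ.tateDual n) v 1 y)) ∧
          (∀ c : shaTwo ρ, (∃ (S₁ : Finset (Place K)) (t : Π v : Place K, galoisCohomology (ρ.toLocal v) 1),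
            S₀ ⊆ S₁ ∧
            (∀ v : HeightOneSpectrum (𝓞 K), (Sum.inr v : Place K) ∉ S₁ →
              t (Sum.inr v) ∈ unramifiedSubgroup (GaloisRep.toLocal v ρ) 1) ∧
            ∀ (y : galoisCohomology (ρ.tateDual n) 1) (S : Finset (Place K)), S₁ ⊆ S →
              (∀ v : HeightOneSpectrum (𝓞 K), (Sum.inr v : Place K) ∉ S →
                galoisCohomology.localization (ρ.tateDual n) (Sum.inr v) 1 y ∈
                  unramifiedSubgroup (GaloisRep.toLocal v (ρ.tateDual n)) 1) →
              e c y = ∑ v ∈ S, localTatePairingZMod ρ n v (LocalInvariants.canonical K n v) (t v)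
                (galoisCohomology.localization (ρ.tateDual n) v 1 y)) → c = 0) ∧
          (∀ φ : galoisCohomology (ρ.tateDual n) 1 →+ ZMod n, ∃ (c : shaTwo ρ) (S₁ : Finset (Place K))
            (t : Π v : Place K, galoisCohomology (ρ.toLocal v) 1),
            ∀ (y : galoisCohomology (ρ.tateDual n) 1) (S : Finset (Place K)), S₁ ⊆ S →
              (∀ v : HeightOneSpectrum (𝓞 K), (Sum.inr v : Place K) ∉ S →
                galoisCohomology.localization (ρ.tateDual n) (Sum.inr v) 1 y ∈
                  unramifiedSubgroup (GaloisRep.toLocal v (ρ.tateDual n)) 1) →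
              (φ - e c) y = ∑ v ∈ S, localTatePairingZMod ρ n v (LocalInvariants.canonical K n v) (t v)
                (galoisCohomology.localization (ρ.tateDual n) v 1 y))) :
    poitouTate_sha_tateDual K := by
  intro n _ M _ _ _ _ ρ hM
  obtain ⟨S₀, hinf, hS₀⟩ := exists_finset_place_isUnramifiedAt ρ n
  obtain ⟨e, hadd, hinj, hsurj⟩ := hR n ρ hM S₀ hinf hS₀
  obtain ⟨h1, h2, b, hb, hbflip⟩ :=
    sha_tateDual_clause_canonical_of_middleExact_of_readout n (hE n) ρ hM S₀ hinf hS₀ e hadd hinj hsurj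
  exact ⟨h1, h2, b, hb, hbflip⟩

/-- **The count form: `Ш¹(K, M^D)`, `Ш²(K, M)` finite and `#Ш²(K, M) ≤ #Ш¹(K, M^D)` for EVERY finite `n`-torsion `M`**,
from (hE) at level `n` and an additive, injective degree-2 readout — ANY number field; the ramification set is produced
inside.  (What crux K4 consumes of `poitouTate_sha_tateDual ℚ`.) [cite: MilneADT2006, Ch. I, Thm. 4.10 (a)(b) and proof] -/
theorem natCard_shaTwo_le_of_middleExact_of_readout (n : ℕ) [NeZero n]
    (hE : ∀ ⦃M : Type⦄ [AddCommGroup M] [TopologicalSpace M] [DiscreteTopology M] [Finite M]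
      (ρ : DiscreteGaloisModule K M), (∀ m : M, n • m = 0) →
      ∀ S : Finset (Place K), (∀ w : InfinitePlace K, (Sum.inl w : Place K) ∈ S) →
        (∀ v : HeightOneSpectrum (𝓞 K), (Sum.inr v : Place K) ∉ S →
          ((n : ℕ) : 𝓞 K) ∉ v.asIdeal ∧ GaloisRep.IsUnramifiedAt v ρ) →
        ∀ t : Π v : Place K, galoisCohomology (ρ.toLocal v) 1,
          (∀ y : galoisCohomology (ρ.tateDual n) 1,
            (∀ v : HeightOneSpectrum (𝓞 K), (Sum.inr v : Place K) ∉ S →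
              galoisCohomology.localization (ρ.tateDual n) (Sum.inr v) 1 y ∈
                unramifiedSubgroup (GaloisRep.toLocal v (ρ.tateDual n)) 1) →
            ∑ v ∈ S, localTatePairingZMod ρ n v (LocalInvariants.canonical K n v) (t v)
              (galoisCohomology.localization (ρ.tateDual n) v 1 y) = 0) →
          ∃ x : galoisCohomology ρ 1,
            (∀ v : HeightOneSpectrum (𝓞 K), (Sum.inr v : Place K) ∉ S →
              galoisCohomology.localization ρ (Sum.inr v) 1 x ∈
                unramifiedSubgroup (GaloisRep.toLocal v ρ) 1) ∧
            ∀ v ∈ S, galoisCohomology.localization ρ v 1 x = t v)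
    {M : Type} [AddCommGroup M] [TopologicalSpace M] [DiscreteTopology M] [Finite M]
    (ρ : DiscreteGaloisModule K M) (hM : ∀ m : M, n • m = 0)
    (hR : ∀ S₀ : Finset (Place K), (∀ w : InfinitePlace K, (Sum.inl w : Place K) ∈ S₀) →
        (∀ v : HeightOneSpectrum (𝓞 K), (Sum.inr v : Place K) ∉ S₀ →
          ((n : ℕ) : 𝓞 K) ∉ v.asIdeal ∧ GaloisRep.IsUnramifiedAt v ρ) →
        ∃ e : shaTwo ρ → (galoisCohomology (ρ.tateDual n) 1 →+ ZMod n),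
          (∀ c c' : shaTwo ρ, ∃ (S₁ : Finset (Place K)) (t : Π v : Place K, galoisCohomology (ρ.toLocal v) 1),
            ∀ (y : galoisCohomology (ρ.tateDual n) 1) (S : Finset (Place K)), S₁ ⊆ S →
              (∀ v : HeightOneSpectrum (𝓞 K), (Sum.inr v : Place K) ∉ S →
                galoisCohomology.localization (ρ.tateDual n) (Sum.inr v) 1 y ∈
                  unramifiedSubgroup (GaloisRep.toLocal v (ρ.tateDual n)) 1) →
              (e (c + c') - e c - e c') y =
                ∑ v ∈ S, localTatePairingZMod ρ n v (LocalInvariants.canonical K n v) (t v)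
                  (galoisCohomology.localization (ρ.tateDual n) v 1 y)) ∧
          (∀ c : shaTwo ρ, (∃ (S₁ : Finset (Place K)) (t : Π v : Place K, galoisCohomology (ρ.toLocal v) 1),
            S₀ ⊆ S₁ ∧
            (∀ v : HeightOneSpectrum (𝓞 K), (Sum.inr v : Place K) ∉ S₁ →
              t (Sum.inr v) ∈ unramifiedSubgroup (GaloisRep.toLocal v ρ) 1) ∧
            ∀ (y : galoisCohomology (ρ.tateDual n) 1) (S : Finset (Place K)), S₁ ⊆ S →
              (∀ v : HeightOneSpectrum (𝓞 K), (Sum.inr v : Place K) ∉ S →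
                galoisCohomology.localization (ρ.tateDual n) (Sum.inr v) 1 y ∈
                  unramifiedSubgroup (GaloisRep.toLocal v (ρ.tateDual n)) 1) →
              e c y = ∑ v ∈ S, localTatePairingZMod ρ n v (LocalInvariants.canonical K n v) (t v)
                (galoisCohomology.localization (ρ.tateDual n) v 1 y)) → c = 0)) :
    Finite (sha (ρ.tateDual n)) ∧ Finite (shaTwo ρ) ∧ Nat.card (shaTwo ρ) ≤ Nat.card (sha (ρ.tateDual n)) := by
  obtain ⟨S₀, hinf, hS₀⟩ := exists_finset_place_isUnramifiedAt ρ n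
  obtain ⟨e, hadd, hinj⟩ := hR S₀ hinf hS₀
  exact natCard_shaTwo_le_canonical_of_middleExact_of_readout n hE ρ hM S₀ hinf hS₀ e hadd hinj

end Summit.BirchSwinnertonDyer.BirchSwinnertonDyer.Theorems.SignedEC.MuReal

end
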